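import Summits.Ventures.QEC.Census.CSSNormalFormSAT.EncodeSoundSym
import Summits.Ventures.QEC.Census.CSSNormalFormSAT.CubeCover
import HarnessLib

/-!
# Refuting a normal-form instance through a cube cover (KERNEL-PLAN items 4/5)

`false_of_cubeCover`: if a Boolean matrix `P` satisfies `ZCond`, `XCond`, `LexCond` for `c` (`1 ≤ w ≤ m`) and EVERY leaf of a well-formed
cube tree `t` has a kernel refutation of `NFEnc.cnf c ++ (leaf units)`, then `False` — the leaf whose units are true under `assignP c P`
(`CubeTree.exists_leaf_allTrue`) contradicts `false_of_unsat_units`. Used with the `CoverB<b>W<w>.lean` dispatch theorems. [folklore]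
-/

set_option autoImplicit false

namespace Summit.Ventures.QEC.Census.CSSNormalFormSAT

/-- **Cube-cover refutation.** [folklore] -/
theorem false_of_cubeCover (c : NFEnc.Cfg) (P : ℕ → ℕ → Bool) (hw1 : 1 ≤ c.w) (hwm : c.w ≤ c.m)
    (hZ : ZCond c P) (hX : XCond c P) (hL : LexCond c P) (t : CubeTree) (hwf : t.WellFormed)
    (hleaves : ∀ kl ∈ CubeTree.leaves t [],
      Sat.Fmla.proof (List.map (fun cl : List ℤ => cl.map Sat.Literal.ofInt) (NFEnc.cnf c ++ kl.2.map fun l => [l])) Sat.Clause.nil) :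
    False := by
  obtain ⟨kl, hkl, hall⟩ := CubeTree.exists_leaf_allTrue (assignP c P) t [] hwf (by simp)
  have hnz := CubeTree.ne_zero_of_mem_leaves t [] hwf (by simp) kl hkl
  refine false_of_unsat_units c P hw1 hwm hZ hX hL (kl.2.map fun l => [l]) ?_ (hleaves kl hkl)
  intro u hu
  obtain ⟨l, hl, rfl⟩ := List.mem_map.1 hu
  refine ⟨l, List.mem_singleton_self l, hnz l hl, ?_, hall l hl⟩
  intro l' hl'
  rw [List.mem_singleton] at hl'
  subst hl'
  exact hnz _ hl

end Summit.Ventures.QEC.Census.CSSNormalFormSAT
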